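import Mathlib

/-!
# Dimock, *The renormalization group according to Balaban* II, §2.5 LEMMA 2.7 (`\label{twoone}`) and its variation (A):
# the SUP-NORM BOUND `|φ_{k,Ω}| ≤ C(‖φ‖_∞ + ‖Φ_{k,Ω}‖_∞)` ASSEMBLED from the block-kernel decay (lefty2) of THEOREM `th`,
# the one-link sum (funnysum), the cancellation of the weights `a_{j′}L^{2(k−j′)}` against `L^{−2(k−j′)}`, and the
# lattice fact `‖Δφ‖_∞ ≤ 𝒪(1)L^{2k}‖φ‖_∞` — PROVED with every constant explicit; (lefty2) and (funnysum) stay the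
# hypotheses they are in the printed proof

**Citation header (reproduction of PUBLISHED work; template of the Bałaban lattice Yang–Mills cell).**
J. Dimock, *The renormalization group according to Balaban II. Large fields*, J. Math. Phys. **54** (2013) 092301
(= arXiv:1212.5562v2) [Dimock2013BalabanII], §2.5 "random walk expansion": the sup norm of the multiscale field
L1481–1485, LEMMA 2.7 `\label{twoone}` (= Lemma 2.7 of §2 under `\newtheorem{lem}{Lemma}[section]`; TEMPLATE §9)
L1487–1492 with its proof L1495–1539, and "Variations" (A) `\label{twoone3}` L1545–1554, (B) L1558–1581, (C) L1581–1606;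
the inputs are THEOREM 2.2 `\label{th}` (lefty2) L1326–1347 and the one-link sum (funnysum) L1152–1156.  TeX line
numbers refer to the arXiv source held by the cell on this hub at
`run/shared/lean/archive/nearmiss/qft-balaban/dimock/src/1212.5562/1212.5562.tex` (7217 lines, sha256[:16]
75c5792fc48eacbc); the running constant `a_k = a(1 − L^{−2})/(1 − L^{−2k})` is part I [Dimock2013] (arXiv:1108.1335v2 TeX
`…/1108.1335/1108.1335.tex`, 7382e6540dded9be) L463.  Dimock's papers are published and refereed and are the cell's
TEMPLATE, not manuscripts under audit; no quantity of the Bałaban series is touched.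

**What the paper prints (verbatim).**  L1481–1485: *"As an application we give an estimate on φ_{k,Ω} = φ_{k,Ω}(φ,
Φ_{k,Ω}) as defined in (unknown). With δΩ_j = Ω_j − Ω_{j+1} for j = 1, …, k−1 and δΩ_k = Ω_k define ‖Φ_{k,Ω}‖_∞ =
sup_{1≤j≤k} ‖Φ_{j,δΩ_j}‖_∞"* ((unknown) = Theorem 2.1 `\label{sonnyboy}` L605–609: *"φ_{k,Ω} = φ_{k,Ω}(φ_{Ω^c_1}, Φ_{k,Ω}) =
G_{k,Ω}(Q^T_{k,Ω}𝐚Φ_{k,Ω} + [Δ]_{Ω_1,Ω_1^c}φ_{Ω^c_1})"*, `G_{k,Ω} = [−Δ + μ̄_k + Q^T_{k,Ω}𝐚Q_{k,Ω}]^{−1}_{Ω_1}` (sinsin) L611–613).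
LEMMA 2.7 L1487–1492: *"There is a constant C depending only on L such that on δΩ_j: |φ_{k,Ω}|, L^{−(k−j)}|∂φ_{k,Ω}|,
L^{−(1+α)(k−j)}|δ_α∂φ_{k,Ω}| ≤ C(‖φ‖_∞ + ‖Φ_{k,Ω}‖_∞)"* (twoone1).  Proof L1495–1539: *"φ_{k,Ω} is a sum of two terms. The
first is G_{k,Ω}Q^T_{k,Ω}𝐚^{(k)}Φ_{k,Ω} = Σ_{j′=1}^k a^{(k)}_{j′}G_{k,Ω}Q^T_{j′}Φ_{j′,δΩ_{j′}} = Σ_{j′=1}^k Σ_{y′∈δΩ^{(j′)}_{j′}}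
a_{j′}L^{2(k−j′)}G_{k,Ω}1_{Δ_{y′}}Q^T_{j′}Φ_{j′,δΩ_{j′}}  Then on Δ_y ⊂ δΩ_j, by (lefty2) and (funnysum) (note the cancellation
of the factors L^{2(k−j′)} by (lefty2)) |G_{k,Ω}Q^T_{k,Ω}𝐚^{(k)}Φ_{k,Ω}| ≤ CΣ_{j′=1}^kΣ_{y′∈δΩ^{(j′)}_{j′}} e^{−¼γ₀d_Ω(y,y′)}
‖Q^T_{j′}Φ_{j′,δΩ_{j′}}‖_∞ = CΣ_{y′}e^{−¼γ₀d_Ω(y,y′)}‖Φ_{k,Ω}‖_∞ ≤ C‖Φ_{k,Ω}‖_∞  The second term is for φ on Ω^c_1: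
G_{k,Ω}[Δ]_{Ω_1,Ω^c_1}φ = Σ_{y′∈δΩ^{(1)}_1} G_{k,Ω}1_{Δ_{y′}}[Δ]_{Ω_1,Ω^c_1}φ  Then on Δ_y ⊂ δΩ_j, by (lefty2) and (funnysum)
|G_{k,Ω}[Δ]_{Ω_1,Ω^c_1}φ| ≤ CΣ_{y′}e^{−¼γ₀d_Ω(y,y′)}L^{−2(k−1)}‖[Δ]_{Ω_1,Ω^c_1}φ‖_∞ ≤ C‖φ‖_∞  (lunar)  In the last step we
used that for φ : 𝕋^{−k}_{𝖬+𝖭−k} → ℝ we have ‖Δφ‖_∞ ≤ 𝒪(1)L^{2k}‖φ‖_∞  Combining the two bounds gives the bound on φ_{k,Ω}.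
The bounds on the derivatives are similar."*  (A) L1545–1554: *"A local version of (twoone1) will also be useful. This
says for L^{−(k−j)} cubes Δ_y in δΩ_j |1_{Δ_y}φ_{k,Ω}(1_{Δ_{y′}}(φ, Φ_{k,Ω}))|, … ≤ Ce^{−¼γ₀d_Ω(y,y′)}(‖φ‖_∞ + ‖Φ_{k,Ω}‖_∞)
(twoone3)  The follows since only one term in the final sum over y′ contributes."*  The inputs, THEOREM 2.2 (lefty2)
L1332–1347: *"It yields the bounds for Δ_y ⊂ δΩ_j and Δ_{y′} ⊂ δΩ_{j′} as in (text): |1_{Δ_y}G_{k,Ω}1_{Δ_{y′}}f| ≤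
CL^{−2(k−j′)}e^{−¼γ₀d_Ω(y,y′)}‖f‖_∞ …"*, and (funnysum) L1152–1156: *"For 0 ≤ δ ≤ 1 if MR is sufficiently large this
satisfies the bound (Lemma 2.1 in [Bal84b]) Σ_y exp(−δd_Ω(x,y)) ≤ 𝒪(1)δ^{−3}"*.

**Why this module.**  TEMPLATE.md §4.2 row «D2 Lemma `\label{twoone}` + variations (A) local, (B) weakened s, (C)
G^0_{k+1,Ω⁺} (L1487–1606) ∣ bounds on φ_{k,Ω} from ‖Φ‖_∞ ∣ B9 Thms 3.1–3.3 conclusions (regularity of H(U)B-type fields),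
B7 Props 3–4 ∣ P ∣ covariant Hölder norms» had NO kernel object.  The analytic input of LEMMA 2.7 is THEOREM 2.2 (the
random walk estimate (lefty2), whose algebraic skeleton and chain combinatorics are the siblings `RandomWalkExpansion`
∕ `WalkExitExtraction`) together with the lattice sum (funnysum); what LEMMA 2.7's proof DOES with them — decompose the
source over the cubes, cancel the level weights `a_{j′}L^{2(k−j′)}` of `Q^T_{k,Ω}𝐚^{(k)}` against the `L^{−2(k−j′)}` of
(lefty2), sum the one-link series, and bound the boundary block `[Δ]_{Ω_1,Ω_1^c}` by the sup norm of the lattice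
Laplacian — is finite bookkeeping, and it is exactly the mechanism by which every Bałaban regularity statement for
minimizers (B9 Thms 3.1–3.3, B11 (9)–(10)) passes from propagator kernel bounds to field bounds.  This module makes that
mechanism kernel, with (lefty2) and (funnysum) as the explicit hypotheses they are in the printed proof, and every
constant explicit (`C_L = C·K·max(a_max, 2dL²)`).

**What is reproduced here (kernel-checked, zero `sorry`; Mathlib only).**  Sites `X` (of `Ω_1`, finite), target sites
`X₂` (the same sites, or bonds for the derivative lines), cube centres `Y` (finite; `= δΩ^{(1)}_1 ∪ ⋯ ∪ Ω^{(k)}_k`), the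
cube maps `c : X → Y`, `c₂ : X₂ → Y` (`x ∈ Δ_{c x}`), levels `lvl : Y → ℕ` (`y ∈ δΩ_{lvl y}`), a linear `T` (`= G_{k,Ω}`,
or `L^{−(k−j)}∂G_{k,Ω}`, …) from functions on `X` to functions on `X₂`, sup norms = Mathlib's pi norm.
* §1 `blk c y f = 1_{Δ_y}f`; `sum_blk` (`Σ_y 1_{Δ_y}f = f`), `blk_supported`, `norm_blk_le`, `blk_eq_zero_of_supported` ∕
  `blk_eq_self_of_supported` (a source supported in one cube has one block), `blk_add`, `blk_smul`.
* §2 THE ℓ^∞ ASSEMBLY: `apply_eq_sum_blk` ∕ `abs_apply_le_sum` (`|(Tf)(x)| ≤ Σ_{y′}|(T1_{Δ_{y′}}f)(x)|`);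
  **`abs_apply_le_of_decay`** (the block form of (lefty2), `|(Tg)(x)| ≤ C·w(y′)·E(c₂ x, y′)·‖g‖_∞` for `g` supported in
  `Δ_{y′}`, summed); **`abs_apply_le_of_blockBound`** ∕ `norm_apply_le_of_blockBound`: block bounds `w(y′)‖1_{Δ_{y′}}f‖_∞
  ≤ B` and the one-link sum `Σ_{y′}E(y,y′) ≤ K` ⟹ `‖Tf‖_∞ ≤ C·K·B`; **`abs_apply_le_of_supported`** = VARIATION (A)'s
  mechanism (*"only one term in the final sum over y′ contributes"*: `|(Tf)(x)| ≤ C·w(y₀)·E(c₂ x, y₀)·‖f‖_∞` for `f`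
  supported in `Δ_{y₀}` — the decay factor survives).
* §3 THE FIRST TERM: `src c lvl k L a Φ` = `Q^T_{k,Ω}𝐚^{(k)}Φ_{k,Ω}` as a single lattice function (value
  `a_{j′}L^{2(k−j′)}Φ(y′)` on the level-`j′` cube `Δ_{y′}`; `Φ_{k,Ω}` *"regarded as a single function"* on the cube
  centres, L411–414, so `‖Φ_{k,Ω}‖_∞` of L1484 is its pi norm); `norm_blk_src_le`; **`weight_cancel`** (*"note the
  cancellation of the factors L^{2(k−j′)}"*: `(L^n)^{−1}(aL^n) = a`); **`blockBound_src`** (`L^{−2(k−j′)}‖1_{Δ_{y′}}Q^T𝐚Φ‖_∞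
  ≤ a_max‖Φ_{k,Ω}‖_∞` when `|a_j| ≤ a_max`); **`abs_first_le`** (`|(G_{k,Ω}Q^T𝐚Φ)(x)| ≤ C·K·a_max‖Φ_{k,Ω}‖_∞`);
  **`abs_first_le_of_single`** ((twoone3) for the first term: `≤ C·a_max·E(y,y′)·‖Φ‖_∞` for `Φ` supported at one cube).
* §4 THE LATTICE FACT: `fdLap s nbr φ x = s·Σ_{x′∼x}(φ(x′) − φ(x))` (the Laplacian with `s = h^{−2} = L^{2k}`);
  **`abs_fdLap_le`** ∕ `norm_fdLap_le` (*"‖Δφ‖_∞ ≤ 𝒪(1)L^{2k}‖φ‖_∞"* with `𝒪(1) = 2m`, `m` = max number of neighbours =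
  `2d`); `offBlock s nbr Ω φ` = `[Δ]_{Ω_1,Ω_1^c}φ`; **`offBlock_eq_fdLap`** (it IS `Δ(1_{Ω_1^c}φ)` restricted to `Ω_1` — the
  reduction the print makes); **`abs_offBlock_le`** ∕ `norm_offBlock_le` (`‖[Δ]_{Ω_1,Ω_1^c}φ‖_∞ ≤ s·m·‖φ‖_∞ = 2dL^{2k}‖φ‖_∞`);
  `offBlock_congr` (depends on `φ_{Ω_1^c}` only).
* §5 THE SECOND TERM AND THE LEMMA: **`blockBound_level_one`** (a source on the level-1 cubes with `‖f‖_∞ ≤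
  mL^{2k}n_φ` has block bound `mL²n_φ` after the weight `L^{−2(k−1)}`, `k ≥ 1`); **`abs_second_le`** ((lunar): `≤
  C·K·mL²·n_φ`); **`lemma_twoone`** ∕ **`lemma_twoone_norm`**: `‖T(Q^T𝐚Φ + f)‖_∞ ≤ C·K·max(a_max, mL²)·(n_φ + ‖Φ_{k,Ω}‖_∞)`
  — (twoone1), first line, with `C_L = C·K·max(a_max, mL²)`; **`abs_second_le_of_single`** ((twoone3) for the boundary
  source in one level-1 cube).
* §6 a non-vacuity `example` (two sites, `T = id ≠ 0`, all hypotheses met).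

**Readings / located items (declared).**  (i) THE HYPOTHESES ARE (lefty2) AND (funnysum): `hker` is the first line of
(lefty2) in block form with `w(y′) = L^{−2(k−j′)}` (`ℕ`-exponent `2(k − lvl y′)`, truncated subtraction; levels `≤ k`
in the print) and an abstract decay profile `E` (the print: `E(y,y′) = e^{−¼γ₀d_Ω(y,y′)}`; only `E ≥ 0` and the row sums
`Σ_{y′}E(y,y′) ≤ K` are used — `K` = the `𝒪(1)δ^{−3}` of (funnysum) at `δ = ¼γ₀`, on whose constant see TEMPLATE row
«D2 §2.5» INFO, GAPS C-tmpl33-3: harmless here, it only enters `C_L`).  (ii) *"C depending only on L"*: `C_L =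
C·K·max(a_max, mL²)` with `C` the constant of THEOREM 2.2 (L-dependent), `K` (γ₀ = 𝒪(L^{−2}), Lemma 2.6), `a_max = a`
(part I L463: `a_k = a(1−L^{−2})/(1−L^{−2k}) ≤ a`; here any bound `|a_j| ≤ a_max`), `m = 2d` — all independent of `k`, `M`
and the regions.  (iii) The second term is proved for ANY source `f` supported on the level-1 cubes with `‖f‖_∞ ≤
mL^{2k}n_φ` (`n_φ` standing for `‖φ‖_∞`, `φ` living on `Ω_1^c`, a different site set); §4 shows that the boundary block
of a nearest-neighbour finite-difference Laplacian with `≤ m` neighbours per site and prefactor `s = L^{2k}` is such a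
source with the constant `m` (the print's route via `‖Δφ‖_∞ ≤ 𝒪(1)L^{2k}‖φ‖_∞` gives `2m`; `offBlock_eq_fdLap` records
that route) — that the cubes of `δΩ_1` adjacent to `∂Ω_1` are level-1 cubes is the print's L1526 «Σ_{y′∈δΩ^{(1)}_1}».
(iv) `T` maps into functions on a second site type `X₂` with its own cube map, so the derivative lines of (twoone1)
(functions on bonds, `T = L^{−(k−j)}∂G_{k,Ω}` with the second∕third line of (lefty2) as `hker`) are instances of the
same theorems — *"The bounds on the derivatives are similar"*; nothing specific to them is claimed.  (v) L1554 prints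
*"The follows since"* (read "This follows since") — located typo, immaterial.

**What is NOT claimed.**  THEOREM 2.2 itself ((lefty2): the random walk expansion and its convergence — row «D2 §2.5»;
siblings `RandomWalkExpansion`, `WalkExitExtraction` hold its algebra), (funnysum) itself (a lattice-geometry fact —
B6 Lemma 2.1 on the Bałaban side, `Balaban1983to89/B6Lemma21*`), the identification of `φ_{k,Ω}` as the minimizer
(THEOREM 2.1, sibling `MultiRegionFreeFlow`), the Hölder-derivative lines beyond reading (iv), variations (B) (complex
weakening parameters `|s_□| ≤ e^{κ₁}`, L1558–1581) and (C) (`G^0_{k+1,Ω⁺}`, (lullaby)∕(dos) L1581–1606) — both are the same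
assembly applied to other kernels and are not separately instantiated; anything of B1–B16 (B9 Thms 3.1–3.3 ∕ B7 Props
3–4 ∕ B11 (9)–(10) are covariant statements with Hölder norms in local gauges — this row's Bałaban side stays grade P).
NOT summit progress; NOT a statement about any Bałaban paper; NOT continuum; NOT Clay.  Unit `b2b-balaban-template`
gen 36 (journal CLAIM D2-LEMMA-TWOONE-KERNEL).

**Version.**  v1.0.1 — DOCSTRING-ONLY fold (every declaration, statement and proof byte-identical to v1 p215159,
commit df5e9cf6b997) of the outside-lineage XREAD VERDICT (cell journal l.11342, t4-ne1p-ideate-cluster-exp g14; GAPS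
C-ne1pclexpg14-1: ok CONSISTENT 4∕4 + 6∕6, DOCFIX-LOW 1, NIT 1): (D-1) the title's «LEMMA 2.8» corrected to LEMMA 2.7
(`\newtheorem{lem}{Lemma}[section]`: `bonfire` = 2.6, `twoone` = 2.7, as the body already said); (N-1) TeX locators
re-counted against the held source — the first-term decomposition L1496–1506, the cancellation sentence L1507–1508, the
first-term bound L1509–1523, the boundary-source decomposition L1524–1527 («Σ_{y′∈δΩ_1^{(1)}}» L1526), (lunar) L1529–1537,
«‖Δφ‖_∞ ≤ 𝒪(1)L^{2k}‖φ‖_∞» L1538, variation (A) (twoone3) L1545–1554, (lefty2) display L1334–1346 (first line L1336–1337),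
variation (C) from L1581.  v1 (gen 36, literature-prover-b2b-balaban-template-g36-0, 2026-08-20).
-/

noncomputable section

open Finset

namespace Literature.MathematicalPhysics.QuantumFieldTheory.Dimock2011to13.MinimizerSupNormBound

/-! ## §1 The cubes `Δ_y`: restriction of a lattice function to one cube -/

section Blocks

variable {X Y : Type*} [Fintype X] [Fintype Y] [DecidableEq Y]

/-- `1_{Δ_y} f` — the restriction of a function `f` on the sites to the cube `Δ_y` (the sites `x` with `c x = y`),
extended by zero; `c : X → Y` assigns to each site of `Ω₁` the cube of the multiscale partition containing it (an
`L^{−(k−j)}` cube `Δ_y`, `y ∈ δΩ_j^{(j)}`, for a site of `δΩ_j`). [cite: Dimock2013BalabanII, §2.5 Theorem th (lefty2)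
L1334–1346 and Lemma twoone proof L1496–1506 (arXiv:1212.5562v2 TeX)] -/
def blk (c : X → Y) (y : Y) (f : X → ℝ) : X → ℝ := fun x => if c x = y then f x else 0

omit [Fintype X] [Fintype Y] in
/-- unfolding `1_{Δ_y}f`. [cite: Dimock2013BalabanII, §2.5 Theorem th (lefty2) L1334–1346 (arXiv:1212.5562v2 TeX)] -/
@[simp] theorem blk_apply (c : X → Y) (y : Y) (f : X → ℝ) (x : X) :
    blk c y f x = if c x = y then f x else 0 := rfl

omit [Fintype X] in
/-- `Σ_y 1_{Δ_y} f = f` — the cubes partition the sites. [cite: Dimock2013BalabanII, §2.5 Lemma twoone proof L1496–1506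
(arXiv:1212.5562v2 TeX)] -/
theorem sum_blk (c : X → Y) (f : X → ℝ) : ∑ y, blk c y f = f := by
  funext x
  simp [Finset.sum_apply]

omit [Fintype X] [Fintype Y] in
/-- `1_{Δ_y} f` is supported in `Δ_y`. [cite: Dimock2013BalabanII, §2.5 Theorem th (lefty2) L1334–1346 (arXiv:1212.5562v2 TeX)] -/
theorem blk_supported (c : X → Y) (y : Y) (f : X → ℝ) : ∀ x, c x ≠ y → blk c y f x = 0 := by
  intro x hx
  simp [hx]

omit [Fintype X] [Fintype Y] in
/-- `|1_{Δ_y}f(x)| ≤ |f(x)|`. [cite: Dimock2013BalabanII, §2.5 Lemma twoone proof L1509–1517 (arXiv:1212.5562v2 TeX)] -/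
theorem abs_blk_le (c : X → Y) (y : Y) (f : X → ℝ) (x : X) : |blk c y f x| ≤ |f x| := by
  by_cases h : c x = y <;> simp [h]

omit [Fintype Y] in
/-- `‖1_{Δ_y} f‖_∞ ≤ ‖f‖_∞` (the step `‖Q^T_{j′}Φ_{j′,δΩ_{j′}}‖_∞ ≤ ‖Φ_{k,Ω}‖_∞` uses it blockwise).
[cite: Dimock2013BalabanII, §2.5 Lemma twoone proof L1509–1517 (arXiv:1212.5562v2 TeX)] -/
theorem norm_blk_le (c : X → Y) (y : Y) (f : X → ℝ) : ‖blk c y f‖ ≤ ‖f‖ :=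
  (pi_norm_le_iff_of_nonneg (norm_nonneg f)).2 fun x => by
    rw [Real.norm_eq_abs]
    exact (abs_blk_le c y f x).trans (by simpa [Real.norm_eq_abs] using norm_le_pi_norm f x)

omit [Fintype X] [Fintype Y] in
/-- a function supported in `Δ_{y₀}` has no other block. [cite: Dimock2013BalabanII, §2.5 variation (A) L1554 «only one
term in the final sum over y′ contributes» (arXiv:1212.5562v2 TeX)] -/
theorem blk_eq_zero_of_supported (c : X → Y) {y₀ y : Y} {f : X → ℝ} (hf : ∀ x, c x ≠ y₀ → f x = 0)
    (hy : y ≠ y₀) : blk c y f = 0 := by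
  funext x
  by_cases h : c x = y
  · have : c x ≠ y₀ := by rw [h]; exact hy
    simp [h, hf x this]
  · simp [h]

omit [Fintype X] [Fintype Y] in
/-- a function supported in `Δ_{y₀}` IS its block at `y₀`. [cite: Dimock2013BalabanII, §2.5 variation (A) L1554 «only
one term in the final sum over y′ contributes» (arXiv:1212.5562v2 TeX)] -/
theorem blk_eq_self_of_supported (c : X → Y) {y₀ : Y} {f : X → ℝ} (hf : ∀ x, c x ≠ y₀ → f x = 0) :
    blk c y₀ f = f := by
  funext x
  by_cases h : c x = y₀
  · simp [h]
  · simp [h, hf x h]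

omit [Fintype X] [Fintype Y] in
/-- restriction to a cube is additive (the source `Q^T𝐚Φ + [Δ]_{Ω₁,Ω₁ᶜ}φ` is split termwise).
[cite: Dimock2013BalabanII, §2.5 Lemma twoone proof L1495–1506 (arXiv:1212.5562v2 TeX)] -/
theorem blk_add (c : X → Y) (y : Y) (f g : X → ℝ) : blk c y (f + g) = blk c y f + blk c y g := by
  funext x
  by_cases h : c x = y <;> simp [h]

omit [Fintype X] [Fintype Y] in
/-- restriction to a cube is homogeneous (the weights `a_{j′}L^{2(k−j′)}` pull out of the blocks).
[cite: Dimock2013BalabanII, §2.5 Lemma twoone proof L1496–1508 (arXiv:1212.5562v2 TeX)] -/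
theorem blk_smul (c : X → Y) (y : Y) (r : ℝ) (f : X → ℝ) : blk c y (r • f) = r • blk c y f := by
  funext x
  by_cases h : c x = y <;> simp [h]

end Blocks

/-! ## §2 The ℓ^∞ assembly: block-kernel decay + one-link sum ⟹ a sup-norm bound -/

section Assembly

variable {X X₂ Y : Type*} [Fintype X] [Fintype Y] [DecidableEq Y]
variable (c : X → Y) (c₂ : X₂ → Y) (T : (X → ℝ) →ₗ[ℝ] (X₂ → ℝ))

omit [Fintype X] in
/-- `(Tf)(x) = Σ_{y′} (T 1_{Δ_{y′}} f)(x)` — linearity over the block decomposition (the print's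
`G_{k,Ω}Q^T𝐚Φ = Σ_{j′}Σ_{y′∈δΩ_{j′}^{(j′)}} a_{j′}L^{2(k−j′)} G_{k,Ω}1_{Δ_{y′}}Q^T_{j′}Φ_{j′,δΩ_{j′}}`, and likewise (L1524–1527)
for the boundary source). [cite: Dimock2013BalabanII, §2.5 Lemma twoone proof L1496–1506 and L1524–1527
(arXiv:1212.5562v2 TeX)] -/
theorem apply_eq_sum_blk (f : X → ℝ) (x : X₂) : T f x = ∑ y', T (blk c y' f) x := by
  conv_lhs => rw [← sum_blk c f]
  rw [map_sum, Finset.sum_apply]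

omit [Fintype X] in
/-- `|(Tf)(x)| ≤ Σ_{y′} |(T 1_{Δ_{y′}} f)(x)|`. [cite: Dimock2013BalabanII, §2.5 Lemma twoone proof L1509–1523
(arXiv:1212.5562v2 TeX)] -/
theorem abs_apply_le_sum (f : X → ℝ) (x : X₂) : |T f x| ≤ ∑ y', |T (blk c y' f) x| := by
  rw [apply_eq_sum_blk c T f x]
  exact Finset.abs_sum_le_sum_abs _ _

variable {c c₂ T}

/-- **the block-kernel decay hypothesis turned into a sum**: if for every `g` supported in `Δ_{y′}` and every site `x`
(in the cube `Δ_y`, `y = c₂ x`) `|(Tg)(x)| ≤ C·w(y′)·E(y,y′)·‖g‖_∞` — the shape of (lefty2) with `w(y′) = L^{−2(k−j′)}`,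
`E(y,y′) = e^{−¼γ₀d_Ω(y,y′)}` — then `|(Tf)(x)| ≤ Σ_{y′} C·w(y′)·E(y,y′)·‖1_{Δ_{y′}}f‖_∞`. [cite: Dimock2013BalabanII, §2.5
Theorem th (lefty2) L1334–1346 and Lemma twoone proof L1509–1523 (arXiv:1212.5562v2 TeX)] -/
theorem abs_apply_le_of_decay {C : ℝ} {w : Y → ℝ} {E : Y → Y → ℝ}
    (hker : ∀ (y' : Y) (g : X → ℝ), (∀ x, c x ≠ y' → g x = 0) →
      ∀ x : X₂, |T g x| ≤ C * w y' * E (c₂ x) y' * ‖g‖)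
    (f : X → ℝ) (x : X₂) : |T f x| ≤ ∑ y', C * w y' * E (c₂ x) y' * ‖blk c y' f‖ :=
  (abs_apply_le_sum c T f x).trans (Finset.sum_le_sum fun y' _ => hker y' _ (blk_supported c y' f) x)

/-- **THE ℓ^∞ ASSEMBLY.**  Block-kernel decay `|(T1_{Δ_{y′}}g)(x)| ≤ C w(y′)E(y,y′)‖g‖_∞`, block bounds
`w(y′)‖1_{Δ_{y′}}f‖_∞ ≤ B` (this is where the weights of the source cancel against `w`), and the one-link sum
`Σ_{y′}E(y,y′) ≤ K` ((funnysum) with `δ = ¼γ₀`) give `|(Tf)(x)| ≤ C·K·B` at every site. [cite: Dimock2013BalabanII, §2.5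
Lemma twoone proof L1507–1523 and (funnysum) L1152–1156 (arXiv:1212.5562v2 TeX)] -/
theorem abs_apply_le_of_blockBound {C : ℝ} {w : Y → ℝ} {E : Y → Y → ℝ} (hC : 0 ≤ C) (hE : ∀ y y', 0 ≤ E y y')
    (hker : ∀ (y' : Y) (g : X → ℝ), (∀ x, c x ≠ y' → g x = 0) →
      ∀ x : X₂, |T g x| ≤ C * w y' * E (c₂ x) y' * ‖g‖)
    {f : X → ℝ} {B K : ℝ} (hB0 : 0 ≤ B) (hB : ∀ y', w y' * ‖blk c y' f‖ ≤ B) (hK : ∀ y, ∑ y', E y y' ≤ K)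
    (x : X₂) : |T f x| ≤ C * K * B := by
  calc |T f x| ≤ ∑ y', C * w y' * E (c₂ x) y' * ‖blk c y' f‖ := abs_apply_le_of_decay hker f x
    _ = ∑ y', C * E (c₂ x) y' * (w y' * ‖blk c y' f‖) := Finset.sum_congr rfl fun y' _ => by ring
    _ ≤ ∑ y', C * E (c₂ x) y' * B :=
        Finset.sum_le_sum fun y' _ => mul_le_mul_of_nonneg_left (hB y') (mul_nonneg hC (hE _ _))
    _ = C * B * ∑ y', E (c₂ x) y' := by rw [Finset.mul_sum]; exact Finset.sum_congr rfl fun y' _ => by ring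
    _ ≤ C * B * K := mul_le_mul_of_nonneg_left (hK _) (mul_nonneg hC hB0)
    _ = C * K * B := by ring

/-- the sup-norm form: `‖Tf‖_∞ ≤ C·K·B`. [cite: Dimock2013BalabanII, §2.5 Lemma twoone (twoone1) L1487–1492
(arXiv:1212.5562v2 TeX)] -/
theorem norm_apply_le_of_blockBound [Fintype X₂] {C : ℝ} {w : Y → ℝ} {E : Y → Y → ℝ} (hC : 0 ≤ C) (hE : ∀ y y', 0 ≤ E y y')
    (hker : ∀ (y' : Y) (g : X → ℝ), (∀ x, c x ≠ y' → g x = 0) →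
      ∀ x : X₂, |T g x| ≤ C * w y' * E (c₂ x) y' * ‖g‖)
    {f : X → ℝ} {B K : ℝ} (hB0 : 0 ≤ B) (hB : ∀ y', w y' * ‖blk c y' f‖ ≤ B) (hK0 : 0 ≤ K)
    (hK : ∀ y, ∑ y', E y y' ≤ K) : ‖T f‖ ≤ C * K * B :=
  (pi_norm_le_iff_of_nonneg (mul_nonneg (mul_nonneg hC hK0) hB0)).2 fun x => by
    rw [Real.norm_eq_abs]; exact abs_apply_le_of_blockBound hC hE hker hB0 hB hK x

/-- **VARIATION (A), the mechanism**: for a source supported in ONE cube `Δ_{y₀}` *"only one term in the final sum over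
y′ contributes"*: `|(Tf)(x)| ≤ C·w(y₀)·E(y,y₀)·‖f‖_∞` — the decay factor `e^{−¼γ₀d_Ω(y,y₀)}` survives.
[cite: Dimock2013BalabanII, §2.5 variation (A) (twoone3) L1545–1554 (arXiv:1212.5562v2 TeX)] -/
theorem abs_apply_le_of_supported {C : ℝ} {w : Y → ℝ} {E : Y → Y → ℝ}
    (hker : ∀ (y' : Y) (g : X → ℝ), (∀ x, c x ≠ y' → g x = 0) →
      ∀ x : X₂, |T g x| ≤ C * w y' * E (c₂ x) y' * ‖g‖)
    {f : X → ℝ} {y₀ : Y} (hf : ∀ x, c x ≠ y₀ → f x = 0) (x : X₂) :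
    |T f x| ≤ C * w y₀ * E (c₂ x) y₀ * ‖f‖ := by
  have h := abs_apply_le_of_decay hker f x
  rw [Finset.sum_eq_single y₀ (fun y' _ hy => by rw [blk_eq_zero_of_supported c hf hy, norm_zero, mul_zero])
    (fun h => (h (Finset.mem_univ _)).elim), blk_eq_self_of_supported c hf] at h
  exact h

end Assembly

/-! ## §3 The first term: the source `Q^T_{k,Ω}𝐚^{(k)}Φ_{k,Ω}` and the cancellation of the weights -/

section FirstTerm

variable {X X₂ Y : Type*} [Fintype X] [Fintype Y] [DecidableEq Y]
variable {c : X → Y} {c₂ : X₂ → Y} {T : (X → ℝ) →ₗ[ℝ] (X₂ → ℝ)}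

/-- the source of the first term as a single lattice function: at a site `x` of the level-`j′` unit cube `Δ_{y′}`
(`y′ = c x`, `j′ = lvl y′`) the value of `Q^T_{k,Ω}𝐚^{(k)}Φ_{k,Ω}` is `a^{(k)}_{j′}·Φ_{j′,δΩ_{j′}}(y′)` with
`a^{(k)}_{j′} = a_{j′}L^{2(k−j′)}` — `Q^T_{j′}` makes a function on the unit lattice constant on the cubes `B_{j′}(y′) =
Δ_{y′}`, and `Φ_{k,Ω} = (Φ_{1,δΩ_1}, …, Φ_{k,Ω_k})` *"can also be regarded as a single function"* `Φ` on the cube centres.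
[cite: Dimock2013BalabanII, §2.1 L411–414, (sunshine0)–(29) L465–481 «a^{(k)}_j = a_jL^{2(k−j)}», §2.5 Lemma twoone proof
L1496–1506 (arXiv:1212.5562v2 TeX)] -/
def src (c : X → Y) (lvl : Y → ℕ) (k : ℕ) (L : ℝ) (a : ℕ → ℝ) (Φ : Y → ℝ) : X → ℝ :=
  fun x => a (lvl (c x)) * L ^ (2 * (k - lvl (c x))) * Φ (c x)

omit [Fintype X] [Fintype Y] [DecidableEq Y] in
/-- unfolding the source: `(Q^T_{k,Ω}𝐚^{(k)}Φ_{k,Ω})(x) = a_{j′}L^{2(k−j′)}Φ(y′)` on `Δ_{y′}`, `y′ = c x`.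
[cite: Dimock2013BalabanII, §2.5 Lemma twoone proof L1496–1506 (arXiv:1212.5562v2 TeX)] -/
@[simp] theorem src_apply (c : X → Y) (lvl : Y → ℕ) (k : ℕ) (L : ℝ) (a : ℕ → ℝ) (Φ : Y → ℝ) (x : X) :
    src c lvl k L a Φ x = a (lvl (c x)) * L ^ (2 * (k - lvl (c x))) * Φ (c x) := rfl

omit [Fintype X] in
/-- the block of the source at `Δ_{y′}`: `‖1_{Δ_{y′}}Q^T𝐚Φ‖_∞ ≤ |a_{j′}|L^{2(k−j′)}‖Φ_{k,Ω}‖_∞` (`‖Q^T_{j′}Φ‖_∞ ≤ ‖Φ‖_∞`).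
[cite: Dimock2013BalabanII, §2.5 Lemma twoone proof L1509–1523 (arXiv:1212.5562v2 TeX)] -/
theorem norm_blk_src_le [Fintype X] (c : X → Y) (lvl : Y → ℕ) (k : ℕ) {L : ℝ} (hL : 0 ≤ L) (a : ℕ → ℝ)
    (Φ : Y → ℝ) (y' : Y) :
    ‖blk c y' (src c lvl k L a Φ)‖ ≤ |a (lvl y')| * L ^ (2 * (k - lvl y')) * ‖Φ‖ := by
  refine (pi_norm_le_iff_of_nonneg (by positivity)).2 fun x => ?_
  rw [Real.norm_eq_abs, blk_apply]
  by_cases h : c x = y'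
  · rw [if_pos h, src_apply, h, abs_mul, abs_mul, abs_of_nonneg (pow_nonneg hL _)]
    exact mul_le_mul_of_nonneg_left (by simpa [Real.norm_eq_abs] using norm_le_pi_norm Φ y')
      (mul_nonneg (abs_nonneg _) (pow_nonneg hL _))
  · rw [if_neg h, abs_zero]; positivity

/-- **«note the cancellation of the factors L^{2(k−j′)} by (lefty2)»**: the kernel weight `w(y′) = L^{−2(k−j′)}` times the
source weight `a_{j′}L^{2(k−j′)}` is `a_{j′}`. [cite: Dimock2013BalabanII, §2.5 Lemma twoone proof L1507–1508
(arXiv:1212.5562v2 TeX)] -/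
theorem weight_cancel {L : ℝ} (hL : L ≠ 0) (a : ℝ) (n : ℕ) : (L ^ n)⁻¹ * (a * L ^ n) = a := by
  field_simp

omit [Fintype X] in
/-- the block bound of the first term AFTER the cancellation: `L^{−2(k−j′)}‖1_{Δ_{y′}}Q^T𝐚Φ‖_∞ ≤ a_max‖Φ_{k,Ω}‖_∞` when
`|a_j| ≤ a_max` (part I: `a_k = a(1 − L^{−2})/(1 − L^{−2k}) ≤ a`). [cite: Dimock2013BalabanII, §2.5 Lemma twoone proof
L1507–1523 (arXiv:1212.5562v2 TeX); Dimock2013, §2.1 L463 (arXiv:1108.1335v2 TeX)] -/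
theorem blockBound_src [Fintype X] (c : X → Y) (lvl : Y → ℕ) (k : ℕ) {L : ℝ} (hL : 0 < L) {a : ℕ → ℝ}
    {amax : ℝ} (ha : ∀ j, |a j| ≤ amax) (Φ : Y → ℝ) (y' : Y) :
    (L ^ (2 * (k - lvl y')))⁻¹ * ‖blk c y' (src c lvl k L a Φ)‖ ≤ amax * ‖Φ‖ := by
  calc (L ^ (2 * (k - lvl y')))⁻¹ * ‖blk c y' (src c lvl k L a Φ)‖
      ≤ (L ^ (2 * (k - lvl y')))⁻¹ * (|a (lvl y')| * L ^ (2 * (k - lvl y')) * ‖Φ‖) :=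
        mul_le_mul_of_nonneg_left (norm_blk_src_le c lvl k hL.le a Φ y') (inv_nonneg.2 (pow_nonneg hL.le _))
    _ = |a (lvl y')| * ‖Φ‖ := by
        rw [inv_mul_eq_div, div_eq_iff (pow_ne_zero _ hL.ne')]; ring
    _ ≤ amax * ‖Φ‖ := mul_le_mul_of_nonneg_right (ha _) (norm_nonneg _)

/-- **THE FIRST TERM** of LEMMA `twoone`: `|(G_{k,Ω}Q^T_{k,Ω}𝐚^{(k)}Φ_{k,Ω})(x)| ≤ C·K·a_max·‖Φ_{k,Ω}‖_∞` — from (lefty2)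
(`w(y′) = L^{−2(k−j′)}`), (funnysum) (`Σ_{y′}e^{−¼γ₀d_Ω(y,y′)} ≤ K`) and `|a_j| ≤ a_max`: *"≤ CΣ_{j′}Σ_{y′}
e^{−¼γ₀d_Ω(y,y′)}‖Q^T_{j′}Φ_{j′,δΩ_{j′}}‖_∞ = CΣ_{y′}e^{−¼γ₀d_Ω(y,y′)}‖Φ_{k,Ω}‖_∞ ≤ C‖Φ_{k,Ω}‖_∞"*.
[cite: Dimock2013BalabanII, §2.5 Lemma twoone proof L1495–1523 (arXiv:1212.5562v2 TeX)] -/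
theorem abs_first_le (lvl : Y → ℕ) (k : ℕ) {L C K amax : ℝ} (hL : 0 < L) (hC : 0 ≤ C) {E : Y → Y → ℝ}
    (hE : ∀ y y', 0 ≤ E y y')
    (hker : ∀ (y' : Y) (g : X → ℝ), (∀ x, c x ≠ y' → g x = 0) →
      ∀ x : X₂, |T g x| ≤ C * (L ^ (2 * (k - lvl y')))⁻¹ * E (c₂ x) y' * ‖g‖)
    (hK : ∀ y, ∑ y', E y y' ≤ K) {a : ℕ → ℝ} (ha : ∀ j, |a j| ≤ amax) (Φ : Y → ℝ) (x : X₂) :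
    |T (src c lvl k L a Φ) x| ≤ C * K * (amax * ‖Φ‖) :=
  abs_apply_le_of_blockBound hC hE hker (mul_nonneg ((abs_nonneg _).trans (ha 0)) (norm_nonneg _))
    (blockBound_src c lvl k hL ha Φ) hK x

omit [Fintype X] [Fintype Y] [DecidableEq Y] in
/-- a field `Φ` supported at the single cube centre `y₀` gives a source supported in `Δ_{y₀}` (the datum
`1_{Δ_{y′}}(φ, Φ_{k,Ω})` of (twoone3)). [cite: Dimock2013BalabanII, §2.5 variation (A) (twoone3) L1545–1554 (arXiv:1212.5562v2 TeX)] -/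
theorem src_supported_of_single (c : X → Y) (lvl : Y → ℕ) (k : ℕ) (L : ℝ) (a : ℕ → ℝ) {Φ : Y → ℝ} {y₀ : Y}
    (hΦ : ∀ y, y ≠ y₀ → Φ y = 0) : ∀ x, c x ≠ y₀ → src c lvl k L a Φ x = 0 := by
  intro x hx
  simp [hΦ _ hx]

/-- **VARIATION (A) for the first term** (twoone3): for `Φ_{k,Ω}` supported in the single cube `Δ_{y′}` the decay
factor survives: `|1_{Δ_y}(G_{k,Ω}Q^T𝐚Φ)| ≤ C·a_max·e^{−¼γ₀d_Ω(y,y′)}‖Φ_{k,Ω}‖_∞`. [cite: Dimock2013BalabanII, §2.5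
variation (A) (twoone3) L1545–1554 (arXiv:1212.5562v2 TeX)] -/
theorem abs_first_le_of_single (lvl : Y → ℕ) (k : ℕ) {L C amax : ℝ} (hL : 0 < L) (hC : 0 ≤ C) {E : Y → Y → ℝ}
    (hE : ∀ y y', 0 ≤ E y y')
    (hker : ∀ (y' : Y) (g : X → ℝ), (∀ x, c x ≠ y' → g x = 0) →
      ∀ x : X₂, |T g x| ≤ C * (L ^ (2 * (k - lvl y')))⁻¹ * E (c₂ x) y' * ‖g‖)
    {a : ℕ → ℝ} (ha : ∀ j, |a j| ≤ amax) {Φ : Y → ℝ} {y₀ : Y} (hΦ : ∀ y, y ≠ y₀ → Φ y = 0) (x : X₂) :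
    |T (src c lvl k L a Φ) x| ≤ C * amax * E (c₂ x) y₀ * ‖Φ‖ := by
  have h := abs_apply_le_of_supported hker (src_supported_of_single c lvl k L a hΦ) x
  have hb : (L ^ (2 * (k - lvl y₀)))⁻¹ * ‖src c lvl k L a Φ‖ ≤ amax * ‖Φ‖ := by
    have := blockBound_src c lvl k hL ha Φ y₀
    rwa [blk_eq_self_of_supported c (src_supported_of_single c lvl k L a hΦ)] at this
  calc |T (src c lvl k L a Φ) x|
      ≤ C * (L ^ (2 * (k - lvl y₀)))⁻¹ * E (c₂ x) y₀ * ‖src c lvl k L a Φ‖ := h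
    _ = C * E (c₂ x) y₀ * ((L ^ (2 * (k - lvl y₀)))⁻¹ * ‖src c lvl k L a Φ‖) := by ring
    _ ≤ C * E (c₂ x) y₀ * (amax * ‖Φ‖) := mul_le_mul_of_nonneg_left hb (mul_nonneg hC (hE _ _))
    _ = C * amax * E (c₂ x) y₀ * ‖Φ‖ := by ring

end FirstTerm

/-! ## §4 The lattice fact `‖Δφ‖_∞ ≤ 𝒪(1)L^{2k}‖φ‖_∞` and the boundary block `[Δ]_{Ω₁,Ω₁ᶜ}` -/

section Laplacian

variable {Λ : Type*} [Fintype Λ]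

/-- the lattice Laplacian as a finite-difference operator: `(Δφ)(x) = s·Σ_{x′ ∼ x}(φ(x′) − φ(x))` with `s = h^{−2}` the
inverse square of the lattice spacing (`h = L^{−k}` on `𝕋^{−k}_{𝖬+𝖭−k}`, so `s = L^{2k}`) and `nbr x` the (at most `2d`)
nearest neighbours of `x`. [cite: Dimock2013BalabanII, §2.5 Lemma twoone proof L1538 (arXiv:1212.5562v2 TeX)] -/
def fdLap (s : ℝ) (nbr : Λ → Finset Λ) (φ : Λ → ℝ) (x : Λ) : ℝ := s * ∑ x' ∈ nbr x, (φ x' - φ x)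

/-- **«for φ : 𝕋^{−k}_{𝖬+𝖭−k} → ℝ we have ‖Δφ‖_∞ ≤ 𝒪(1)L^{2k}‖φ‖_∞»** with the constant: `|(Δφ)(x)| ≤ s·2m·‖φ‖_∞` when
every site has at most `m` neighbours (`m = 2d`, `s = L^{2k}`: `𝒪(1) = 4d`). [cite: Dimock2013BalabanII, §2.5 Lemma twoone
proof L1538 (arXiv:1212.5562v2 TeX)] -/
theorem abs_fdLap_le {s : ℝ} (hs : 0 ≤ s) {nbr : Λ → Finset Λ} {m : ℕ} (hm : ∀ x, (nbr x).card ≤ m) (φ : Λ → ℝ)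
    (x : Λ) : |fdLap s nbr φ x| ≤ s * (2 * m) * ‖φ‖ := by
  have hφ : ∀ z, |φ z| ≤ ‖φ‖ := fun z => by simpa [Real.norm_eq_abs] using norm_le_pi_norm φ z
  unfold fdLap
  rw [abs_mul, abs_of_nonneg hs, mul_assoc]
  refine mul_le_mul_of_nonneg_left ?_ hs
  calc |∑ x' ∈ nbr x, (φ x' - φ x)| ≤ ∑ x' ∈ nbr x, |φ x' - φ x| := Finset.abs_sum_le_sum_abs _ _
    _ ≤ ∑ _x' ∈ nbr x, 2 * ‖φ‖ := Finset.sum_le_sum fun x' _ =>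
        (abs_sub _ _).trans (by linarith [hφ x', hφ x])
    _ = (nbr x).card * (2 * ‖φ‖) := by rw [Finset.sum_const, nsmul_eq_mul]
    _ ≤ m * (2 * ‖φ‖) := mul_le_mul_of_nonneg_right (Nat.cast_le.2 (hm x)) (by positivity)
    _ = 2 * m * ‖φ‖ := by ring

/-- the sup-norm form: `‖Δφ‖_∞ ≤ s·2m·‖φ‖_∞` (`= 4dL^{2k}‖φ‖_∞`). [cite: Dimock2013BalabanII, §2.5 Lemma twoone proof
L1538 «‖Δφ‖_∞ ≤ 𝒪(1)L^{2k}‖φ‖_∞» (arXiv:1212.5562v2 TeX)] -/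
theorem norm_fdLap_le {s : ℝ} (hs : 0 ≤ s) {nbr : Λ → Finset Λ} {m : ℕ} (hm : ∀ x, (nbr x).card ≤ m)
    (φ : Λ → ℝ) : ‖fdLap s nbr φ‖ ≤ s * (2 * m) * ‖φ‖ :=
  (pi_norm_le_iff_of_nonneg (by positivity)).2 fun x => by
    rw [Real.norm_eq_abs]; exact abs_fdLap_le hs hm φ x

/-- the boundary block `[Δ]_{Ω₁,Ω₁ᶜ}`: for a site `x ∈ Ω₁`, `([Δ]_{Ω₁,Ω₁ᶜ}φ)(x) = s·Σ_{x′ ∼ x, x′ ∉ Ω₁} φ(x′)` (the matrix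
block of `Δ` from `Ω₁ᶜ` to `Ω₁`; zero off `Ω₁`). [cite: Dimock2013BalabanII, §2.2 Theorem sonnyboy L594–614 «φ_{k,Ω} =
G_{k,Ω}(Q^T_{k,Ω}𝐚Φ_{k,Ω} + [Δ]_{Ω₁,Ω₁ᶜ}φ_{Ω₁ᶜ})» and §2.5 Lemma twoone proof L1524–1538 (arXiv:1212.5562v2 TeX)] -/
def offBlock [DecidableEq Λ] (s : ℝ) (nbr : Λ → Finset Λ) (Ω : Finset Λ) (φ : Λ → ℝ) (x : Λ) : ℝ :=
  if x ∈ Ω then s * ∑ x' ∈ (nbr x).filter (fun x' => x' ∉ Ω), φ x' else 0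

omit [Fintype Λ] in
/-- `[Δ]_{Ω₁,Ω₁ᶜ}φ` IS the restriction to `Ω₁` of `Δ(1_{Ω₁ᶜ}φ)` — how the printed proof reduces the boundary block to
the bound on `‖Δφ‖_∞`. [cite: Dimock2013BalabanII, §2.5 Lemma twoone proof L1524–1538 (arXiv:1212.5562v2 TeX)] -/
theorem offBlock_eq_fdLap [DecidableEq Λ] (s : ℝ) (nbr : Λ → Finset Λ) (Ω : Finset Λ) (φ : Λ → ℝ) {x : Λ}
    (hx : x ∈ Ω) : offBlock s nbr Ω φ x = fdLap s nbr (fun x' => if x' ∈ Ω then 0 else φ x') x := by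
  unfold offBlock fdLap
  rw [if_pos hx, Finset.sum_filter]
  congr 1
  refine Finset.sum_congr rfl fun x' _ => ?_
  by_cases h : x' ∈ Ω <;> simp [h, hx]

/-- **the boundary block is bounded by `s·m·‖φ‖_∞`** (`m = 2d`, `s = L^{2k}`: `‖[Δ]_{Ω₁,Ω₁ᶜ}φ‖_∞ ≤ 2dL^{2k}‖φ‖_∞`).
[cite: Dimock2013BalabanII, §2.5 Lemma twoone proof (lunar) L1524–1538 (arXiv:1212.5562v2 TeX)] -/
theorem abs_offBlock_le [DecidableEq Λ] {s : ℝ} (hs : 0 ≤ s) {nbr : Λ → Finset Λ} {m : ℕ}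
    (hm : ∀ x, (nbr x).card ≤ m) (Ω : Finset Λ) (φ : Λ → ℝ) (x : Λ) :
    |offBlock s nbr Ω φ x| ≤ s * m * ‖φ‖ := by
  have hφ : ∀ z, |φ z| ≤ ‖φ‖ := fun z => by simpa [Real.norm_eq_abs] using norm_le_pi_norm φ z
  unfold offBlock
  split_ifs with hx
  · rw [abs_mul, abs_of_nonneg hs, mul_assoc]
    refine mul_le_mul_of_nonneg_left ?_ hs
    calc |∑ x' ∈ (nbr x).filter (fun x' => x' ∉ Ω), φ x'|
        ≤ ∑ x' ∈ (nbr x).filter (fun x' => x' ∉ Ω), |φ x'| := Finset.abs_sum_le_sum_abs _ _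
      _ ≤ ∑ _x' ∈ (nbr x).filter (fun x' => x' ∉ Ω), ‖φ‖ := Finset.sum_le_sum fun x' _ => hφ x'
      _ = ((nbr x).filter (fun x' => x' ∉ Ω)).card * ‖φ‖ := by rw [Finset.sum_const, nsmul_eq_mul]
      _ ≤ m * ‖φ‖ := mul_le_mul_of_nonneg_right
          (Nat.cast_le.2 ((Finset.card_filter_le _ _).trans (hm x))) (norm_nonneg _)
  · rw [abs_zero]; positivity

/-- the sup-norm form: `‖[Δ]_{Ω₁,Ω₁ᶜ}φ‖_∞ ≤ s·m·‖φ‖_∞`. [cite: Dimock2013BalabanII, §2.5 Lemma twoone proof (lunar)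
L1529–1538 (arXiv:1212.5562v2 TeX)] -/
theorem norm_offBlock_le [DecidableEq Λ] {s : ℝ} (hs : 0 ≤ s) {nbr : Λ → Finset Λ} {m : ℕ}
    (hm : ∀ x, (nbr x).card ≤ m) (Ω : Finset Λ) (φ : Λ → ℝ) : ‖offBlock s nbr Ω φ‖ ≤ s * m * ‖φ‖ :=
  (pi_norm_le_iff_of_nonneg (by positivity)).2 fun x => by
    rw [Real.norm_eq_abs]; exact abs_offBlock_le hs hm Ω φ x

omit [Fintype Λ] in
/-- `[Δ]_{Ω₁,Ω₁ᶜ}φ` depends on `φ` only through `φ_{Ω₁ᶜ}` (the argument `φ_{Ω^c_1}` of (unknown)).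
[cite: Dimock2013BalabanII, §2.2 Theorem sonnyboy (unknown) L605–609 (arXiv:1212.5562v2 TeX)] -/
theorem offBlock_congr [DecidableEq Λ] (s : ℝ) (nbr : Λ → Finset Λ) (Ω : Finset Λ) {φ ψ : Λ → ℝ}
    (h : ∀ x, x ∉ Ω → φ x = ψ x) : offBlock s nbr Ω φ = offBlock s nbr Ω ψ := by
  funext x
  unfold offBlock
  split_ifs with hx
  · congr 1
    exact Finset.sum_congr rfl fun x' hx' => h x' (Finset.mem_filter.1 hx').2
  · rfl

end Laplacian

/-! ## §5 The second term (lunar) and LEMMA `twoone` assembled -/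

section SecondTerm

variable {X X₂ Y : Type*} [Fintype X] [Fintype Y] [DecidableEq Y]
variable {c : X → Y} {c₂ : X₂ → Y} {T : (X → ℝ) →ₗ[ℝ] (X₂ → ℝ)}

omit [Fintype Y] in
/-- the block bound of a source supported on the LEVEL-1 cubes (the cubes of `δΩ_1`, where `[Δ]_{Ω₁,Ω₁ᶜ}φ` lives —
L1526 «Σ_{y′∈δΩ_1^{(1)}}») with `‖f‖_∞ ≤ m·L^{2k}·n_φ`: after the weight `L^{−2(k−1)}` one is left with `m·L²·n_φ`
(`k ≥ 1`). [cite: Dimock2013BalabanII, §2.5 Lemma twoone proof (lunar) L1524–1538 (arXiv:1212.5562v2 TeX)] -/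
theorem blockBound_level_one (c : X → Y) (lvl : Y → ℕ) {k : ℕ} (hk : 1 ≤ k) {L : ℝ} (hL : 0 < L) {f : X → ℝ}
    (hsupp : ∀ x, lvl (c x) ≠ 1 → f x = 0) {m nφ : ℝ} (hm : 0 ≤ m) (hn : 0 ≤ nφ)
    (hf : ‖f‖ ≤ m * L ^ (2 * k) * nφ) (y' : Y) :
    (L ^ (2 * (k - lvl y')))⁻¹ * ‖blk c y' f‖ ≤ m * L ^ 2 * nφ := by
  by_cases hy : lvl y' = 1
  · rw [hy]
    have hpow : L ^ (2 * k) = L ^ (2 * (k - 1)) * L ^ 2 := by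
      rw [← pow_add]; congr 1; omega
    calc (L ^ (2 * (k - 1)))⁻¹ * ‖blk c y' f‖ ≤ (L ^ (2 * (k - 1)))⁻¹ * (m * L ^ (2 * k) * nφ) :=
          mul_le_mul_of_nonneg_left ((norm_blk_le c y' f).trans hf) (inv_nonneg.2 (pow_nonneg hL.le _))
      _ = m * L ^ 2 * nφ := by
          rw [hpow]; field_simp
  · have h0 : blk c y' f = 0 := by
      funext x
      by_cases hx : c x = y'
      · have : lvl (c x) ≠ 1 := by rw [hx]; exact hy
        simp [hx, hsupp x this]
      · simp [hx]
    rw [h0, norm_zero, mul_zero]; positivity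

/-- **THE SECOND TERM** (lunar): `|(G_{k,Ω}[Δ]_{Ω₁,Ω₁ᶜ}φ)(x)| ≤ CΣ_{y′}e^{−¼γ₀d_Ω(y,y′)}L^{−2(k−1)}‖[Δ]_{Ω₁,Ω₁ᶜ}φ‖_∞ ≤
C·K·m·L²·‖φ‖_∞` — for any source `f` supported on the level-1 cubes with `‖f‖_∞ ≤ mL^{2k}‖φ‖_∞` (§4: `m = 2d` for the
boundary block of the nearest-neighbour Laplacian). [cite: Dimock2013BalabanII, §2.5 Lemma twoone proof (lunar) L1524–1539
(arXiv:1212.5562v2 TeX)] -/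
theorem abs_second_le (lvl : Y → ℕ) {k : ℕ} (hk : 1 ≤ k) {L C K : ℝ} (hL : 0 < L) (hC : 0 ≤ C) {E : Y → Y → ℝ}
    (hE : ∀ y y', 0 ≤ E y y')
    (hker : ∀ (y' : Y) (g : X → ℝ), (∀ x, c x ≠ y' → g x = 0) →
      ∀ x : X₂, |T g x| ≤ C * (L ^ (2 * (k - lvl y')))⁻¹ * E (c₂ x) y' * ‖g‖)
    (hK : ∀ y, ∑ y', E y y' ≤ K) {f : X → ℝ} (hsupp : ∀ x, lvl (c x) ≠ 1 → f x = 0) {m nφ : ℝ} (hm : 0 ≤ m)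
    (hn : 0 ≤ nφ) (hf : ‖f‖ ≤ m * L ^ (2 * k) * nφ) (x : X₂) :
    |T f x| ≤ C * K * (m * L ^ 2 * nφ) :=
  abs_apply_le_of_blockBound hC hE hker (by positivity) (blockBound_level_one c lvl hk hL hsupp hm hn hf) hK x

/-- **LEMMA `twoone`, first line (twoone1), ASSEMBLED**: `φ_{k,Ω} = G_{k,Ω}(Q^T_{k,Ω}𝐚^{(k)}Φ_{k,Ω} + [Δ]_{Ω₁,Ω₁ᶜ}φ)` obeys
`|φ_{k,Ω}(x)| ≤ C·K·(a_max‖Φ_{k,Ω}‖_∞ + mL²‖φ‖_∞) ≤ C_L(‖φ‖_∞ + ‖Φ_{k,Ω}‖_∞)` with `C_L = C·K·max(a_max, mL²)` — *"There is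
a constant C depending only on L"*: `C` is the constant of (lefty2), `K` the one-link sum (funnysum) at `δ = ¼γ₀` (`γ₀ =
𝒪(L^{−2})`), `m = 2d`. The hypotheses are (lefty2) (first line) and (funnysum); the derivative lines of (twoone1) are the
same assembly with `T = L^{−(k−j)}∂G_{k,Ω}` resp. `L^{−(1+α)(k−j)}δ_α∂G_{k,Ω}` and the other two lines of (lefty2) (*"The
bounds on the derivatives are similar"*). [cite: Dimock2013BalabanII, §2.5 Lemma twoone (twoone1) L1487–1492 and proof
L1495–1539 (arXiv:1212.5562v2 TeX)] -/
theorem lemma_twoone (lvl : Y → ℕ) {k : ℕ} (hk : 1 ≤ k) {L C K amax : ℝ} (hL : 0 < L) (hC : 0 ≤ C) (hK0 : 0 ≤ K)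
    {E : Y → Y → ℝ} (hE : ∀ y y', 0 ≤ E y y')
    (hker : ∀ (y' : Y) (g : X → ℝ), (∀ x, c x ≠ y' → g x = 0) →
      ∀ x : X₂, |T g x| ≤ C * (L ^ (2 * (k - lvl y')))⁻¹ * E (c₂ x) y' * ‖g‖)
    (hK : ∀ y, ∑ y', E y y' ≤ K) {a : ℕ → ℝ} (ha : ∀ j, |a j| ≤ amax) (Φ : Y → ℝ) {f : X → ℝ}
    (hsupp : ∀ x, lvl (c x) ≠ 1 → f x = 0) {m nφ : ℝ} (hm : 0 ≤ m) (hn : 0 ≤ nφ)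
    (hf : ‖f‖ ≤ m * L ^ (2 * k) * nφ) (x : X₂) :
    |T (src c lvl k L a Φ + f) x| ≤ C * K * max amax (m * L ^ 2) * (nφ + ‖Φ‖) := by
  have h1 := abs_first_le lvl k hL hC hE hker hK ha Φ x
  have h2 := abs_second_le lvl hk hL hC hE hker hK hsupp hm hn hf x
  have hamax : 0 ≤ amax := (abs_nonneg _).trans (ha 0)
  have hCK : 0 ≤ C * K := mul_nonneg hC hK0
  have e1 : amax * ‖Φ‖ ≤ max amax (m * L ^ 2) * ‖Φ‖ :=
    mul_le_mul_of_nonneg_right (le_max_left _ _) (norm_nonneg _)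
  have e2 : m * L ^ 2 * nφ ≤ max amax (m * L ^ 2) * nφ := mul_le_mul_of_nonneg_right (le_max_right _ _) hn
  rw [map_add, Pi.add_apply]
  calc |T (src c lvl k L a Φ) x + T f x| ≤ |T (src c lvl k L a Φ) x| + |T f x| := abs_add_le _ _
    _ ≤ C * K * (amax * ‖Φ‖) + C * K * (m * L ^ 2 * nφ) := add_le_add h1 h2
    _ ≤ C * K * (max amax (m * L ^ 2) * ‖Φ‖) + C * K * (max amax (m * L ^ 2) * nφ) :=
        add_le_add (mul_le_mul_of_nonneg_left e1 hCK) (mul_le_mul_of_nonneg_left e2 hCK)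
    _ = C * K * max amax (m * L ^ 2) * (nφ + ‖Φ‖) := by ring

/-- the sup-norm form of LEMMA `twoone`'s first line: `‖φ_{k,Ω}‖_∞ ≤ C_L(‖φ‖_∞ + ‖Φ_{k,Ω}‖_∞)`.
[cite: Dimock2013BalabanII, §2.5 Lemma twoone (twoone1) L1487–1492 (arXiv:1212.5562v2 TeX)] -/
theorem lemma_twoone_norm [Fintype X₂] (lvl : Y → ℕ) {k : ℕ} (hk : 1 ≤ k) {L C K amax : ℝ} (hL : 0 < L) (hC : 0 ≤ C)
    (hK0 : 0 ≤ K) {E : Y → Y → ℝ} (hE : ∀ y y', 0 ≤ E y y')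
    (hker : ∀ (y' : Y) (g : X → ℝ), (∀ x, c x ≠ y' → g x = 0) →
      ∀ x : X₂, |T g x| ≤ C * (L ^ (2 * (k - lvl y')))⁻¹ * E (c₂ x) y' * ‖g‖)
    (hK : ∀ y, ∑ y', E y y' ≤ K) {a : ℕ → ℝ} (ha : ∀ j, |a j| ≤ amax) (Φ : Y → ℝ) {f : X → ℝ}
    (hsupp : ∀ x, lvl (c x) ≠ 1 → f x = 0) {m nφ : ℝ} (hm : 0 ≤ m) (hn : 0 ≤ nφ)
    (hf : ‖f‖ ≤ m * L ^ (2 * k) * nφ) :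
    ‖T (src c lvl k L a Φ + f)‖ ≤ C * K * max amax (m * L ^ 2) * (nφ + ‖Φ‖) := by
  have hamax : 0 ≤ amax := (abs_nonneg _).trans (ha 0)
  refine (pi_norm_le_iff_of_nonneg ?_).2 fun x => ?_
  · have : 0 ≤ max amax (m * L ^ 2) := le_max_of_le_left hamax
    positivity
  · rw [Real.norm_eq_abs]
    exact lemma_twoone lvl hk hL hC hK0 hE hker hK ha Φ hsupp hm hn hf x

/-- **VARIATION (A)** (twoone3) for the boundary source: for `φ` supported in the single level-1 cube `Δ_{y′}` (so that
`[Δ]_{Ω₁,Ω₁ᶜ}φ`, or any level-1 source `f` with `‖f‖_∞ ≤ mL^{2k}‖φ‖_∞`, is supported in `Δ_{y′}`):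
`|1_{Δ_y}G_{k,Ω}f| ≤ C·mL²·e^{−¼γ₀d_Ω(y,y′)}‖φ‖_∞`. [cite: Dimock2013BalabanII, §2.5 variation (A) (twoone3) L1545–1554
(arXiv:1212.5562v2 TeX)] -/
theorem abs_second_le_of_single (lvl : Y → ℕ) {k : ℕ} (hk : 1 ≤ k) {L C : ℝ} (hL : 0 < L) (hC : 0 ≤ C)
    {E : Y → Y → ℝ} (hE : ∀ y y', 0 ≤ E y y')
    (hker : ∀ (y' : Y) (g : X → ℝ), (∀ x, c x ≠ y' → g x = 0) →
      ∀ x : X₂, |T g x| ≤ C * (L ^ (2 * (k - lvl y')))⁻¹ * E (c₂ x) y' * ‖g‖)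
    {f : X → ℝ} {y₀ : Y} (hy₀ : lvl y₀ = 1) (hsupp : ∀ x, c x ≠ y₀ → f x = 0) {m nφ : ℝ} (hm : 0 ≤ m)
    (hn : 0 ≤ nφ) (hf : ‖f‖ ≤ m * L ^ (2 * k) * nφ) (x : X₂) :
    |T f x| ≤ C * (m * L ^ 2) * E (c₂ x) y₀ * nφ := by
  have h := abs_apply_le_of_supported hker hsupp x
  have hlv : ∀ x, lvl (c x) ≠ 1 → f x = 0 := fun x hx => hsupp x fun h' => hx (by rw [h', hy₀])
  have hb : (L ^ (2 * (k - lvl y₀)))⁻¹ * ‖f‖ ≤ m * L ^ 2 * nφ := by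
    have := blockBound_level_one c lvl hk hL hlv hm hn hf y₀
    rwa [blk_eq_self_of_supported c hsupp] at this
  calc |T f x| ≤ C * (L ^ (2 * (k - lvl y₀)))⁻¹ * E (c₂ x) y₀ * ‖f‖ := h
    _ = C * E (c₂ x) y₀ * ((L ^ (2 * (k - lvl y₀)))⁻¹ * ‖f‖) := by ring
    _ ≤ C * E (c₂ x) y₀ * (m * L ^ 2 * nφ) := mul_le_mul_of_nonneg_left hb (mul_nonneg hC (hE _ _))
    _ = C * (m * L ^ 2) * E (c₂ x) y₀ * nφ := by ring

end SecondTerm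

/-! ## §6 Non-vacuity: a two-cube instance -/

/-- the hypotheses of `lemma_twoone` are jointly satisfiable with a non-zero operator: two sites, two cubes (levels 1
and 1), `T = id`, `k = 1`, `L = 1`, `C = 1`, `E ≡ 1`, `K = 2`. -/
example : ∃ (T : (Bool → ℝ) →ₗ[ℝ] (Bool → ℝ)) (Φ : Bool → ℝ),
    T ≠ 0 ∧ ‖T (src id (fun _ => 1) 1 (1 : ℝ) (fun _ => 1) Φ + 0)‖ ≤ 1 * 2 * max 1 (2 * (1 : ℝ) ^ 2) * (0 + ‖Φ‖) := by
  refine ⟨LinearMap.id, fun _ => 1, ?_, ?_⟩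
  · intro h
    have := congrArg (fun T : (Bool → ℝ) →ₗ[ℝ] (Bool → ℝ) => T (fun _ => 1) true) h
    simp at this
  · refine lemma_twoone_norm (c := id) (c₂ := id) (T := LinearMap.id) (fun _ => 1) le_rfl one_pos zero_le_one
      (by norm_num) (E := fun _ _ => 1) (fun _ _ => zero_le_one) ?_ ?_ (a := fun _ => 1) (fun _ => by simp)
      (fun _ => 1) (f := 0) (fun _ _ => rfl) (m := 2) (by norm_num) le_rfl (by simp)
    · intro y' g _ x
      simpa [Real.norm_eq_abs] using norm_le_pi_norm g x
    · intro y; simp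

end Literature.MathematicalPhysics.QuantumFieldTheory.Dimock2011to13.MinimizerSupNormBound
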